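import Summits.CriticalPhenomena.PercolationContinuityZ3.Theorems.PercNearOneGluingNoHeavyLowerTailSahiCombTriWAndSplitCert

/-!
# Admissible weights for row-splitting certificates: up-sets, Kleitman shells, and `[·∈A₂]+[·ᶜ∈A₂]` for `Cor_{A₂} ≥ 0`

Support file of the one-cut programme (crux `NoHeavyLowerTail`, stmt-CriticalPhenomena-4575; unit `prim-lf-1` gen 60, memo
`FROM-prim-lf-1-gen60-ONE-BLOCK.md` §2, §3b).  Companion of `…TriWAndSplitCert`: that file proves THEOREM W and the soundness of row-splitting
certificates for weights `w : 2^{γ₂} → ℕ` that are `Q`-ADMISSIBLE, i.e. satisfy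
`∀ S up-set, 0 ≤ Σ_{y∈Q} w(y)·([y∈S] − [yᶜ∈S])`.  Here we supply the three standard sources of admissible weights, so that certificates can be written
with the lineage's usual data:
* `admissible_ind_upset` — the indicator of an up-set `V` (Kleitman's lemma in the up-set `Q ∩ V`);
* `admissible_ind_klShell` — the indicator of ANY Kleitman shell `T` (the shell inequality with the test pair `(S, Q)`);
* `admissible_wInd_of_corP_nonneg` — the weight `[y∈A₂] + [yᶜ∈A₂]` when `Cor_{A₂} ≥ 0` on up-set pairs (the key identity of `…TriWAndRectangle`);
* `admissible_add`, `admissible_smul` — admissible weights form a cone;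
and `admissible_one` (the constant weight).  (The one-block theorem of `…TriWAndOneBlock` is the one-term certificate `δ_{A₁×univ} = δ_{A₁} ⊗ 1`
for `corP_andProd_nonneg_of_rowSplit`; the rectangle theorem is the two-term certificate `½[δ_{A₁}⊗([·∈A₂]+[·ᶜ∈A₂]) + …]` after clearing the ½.)
HONEST LABEL: complete proofs, std axioms; bookkeeping around `…TriWAndSplitCert`. [this work]
-/

namespace Summit.CriticalPhenomena.PercolationContinuityZ3.Theorems

namespace FiveUpSet

open Finset

variable {γ₁ γ₂ : Type} [DecidableEq γ₁] [Fintype γ₁] [DecidableEq γ₂] [Fintype γ₂]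

/-! ### Sources of admissible weights -/

/-- `Σ_{y∈Q} [y∈X]·([y∈S] − [yᶜ∈S]) = #(X ∩ S ∩ Q) − #(X ∩ refl S ∩ Q)` for any families. [this work] -/
theorem sum_ind_mul_sgn_eq_card_sub (Q X S : Finset (Finset γ₂)) :
    ∑ y ∈ Q, ind X y * (ind S y - ind S yᶜ) = ((X ∩ S ∩ Q).card : ℤ) - (X ∩ refl S ∩ Q).card := by
  have e : ∀ y ∈ Q, ind X y * (ind S y - ind S yᶜ)
      = (if y ∈ X ∩ S then (1 : ℤ) else 0) - (if y ∈ X ∩ refl S then (1 : ℤ) else 0) := by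
    intro y _
    unfold ind
    simp only [mem_inter, mem_refl]
    by_cases h1 : y ∈ X <;> by_cases h2 : y ∈ S <;> by_cases h3 : yᶜ ∈ S <;> simp [h1, h2, h3]
  rw [sum_congr rfl e, sum_sub_distrib, sum_boole, sum_boole]
  congr 2 <;> (congr 1; ext y; simp only [mem_filter, mem_inter]; tauto)

/-- **Up-sets are admissible**: for up-sets `Q, V`, the weight `1_V` is `Q`-admissible (Kleitman in the up-set `V ∩ Q`). [this work] -/
theorem admissible_ind_upset {Q V : Finset (Finset γ₂)} (hQ : IsUpperSet (Q : Set (Finset γ₂))) (hV : IsUpperSet (V : Set (Finset γ₂)))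
    (S : Finset (Finset γ₂)) (hS : IsUpperSet (S : Set (Finset γ₂))) :
    0 ≤ ∑ y ∈ Q, ind V y * (ind S y - ind S yᶜ) := by
  rw [sum_ind_mul_sgn_eq_card_sub, sub_nonneg]
  have hVQ : IsUpperSet ((V ∩ Q : Finset (Finset γ₂)) : Set (Finset γ₂)) := by rw [coe_inter]; exact hV.inter hQ
  have h := card_refl_inter_le hVQ hS
  rw [show refl S ∩ (V ∩ Q) = V ∩ refl S ∩ Q from by ext y; simp only [mem_inter]; tauto,
    show S ∩ (V ∩ Q) = V ∩ S ∩ Q from by ext y; simp only [mem_inter]; tauto] at h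
  exact_mod_cast h

/-- **Kleitman shells are admissible**: for an up-set `Q` and ANY family `T` with `KlShell T`, the weight `1_T` is `Q`-admissible. [this work] -/
theorem admissible_ind_klShell {Q T : Finset (Finset γ₂)} (hQ : IsUpperSet (Q : Set (Finset γ₂))) (hT : KlShell T)
    (S : Finset (Finset γ₂)) (hS : IsUpperSet (S : Set (Finset γ₂))) :
    0 ≤ ∑ y ∈ Q, ind T y * (ind S y - ind S yᶜ) := by
  rw [sum_ind_mul_sgn_eq_card_sub]
  have h := hT S Q hS hQ
  unfold klL at h
  exact h

/-- **`[·∈A₂] + [·ᶜ∈A₂]` is admissible when `Cor_{A₂} ≥ 0`** (the key identity of `…TriWAndRectangle`). [this work] -/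
theorem admissible_wInd_of_corP_nonneg {Q A₂ : Finset (Finset γ₂)} (hQ : IsUpperSet (Q : Set (Finset γ₂)))
    (hcor₂ : ∀ U V : Finset (Finset γ₂), IsUpperSet (U : Set (Finset γ₂)) → IsUpperSet (V : Set (Finset γ₂)) → 0 ≤ corP A₂ U V)
    (S : Finset (Finset γ₂)) (hS : IsUpperSet (S : Set (Finset γ₂))) :
    0 ≤ ∑ y ∈ Q, (ind A₂ y + ind A₂ yᶜ) * (ind S y - ind S yᶜ) := by
  rw [sum_congr rfl fun y _ => by rw [← sgnDiff_refl_eq], sum_wInd_mul_sgnDiff_eq_corP]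
  exact hcor₂ Q S hQ hS

/-- Admissible weights add. [this work] -/
theorem admissible_add {Q : Finset (Finset γ₂)} {w₁ w₂ : Finset γ₂ → ℤ}
    (h₁ : ∀ S : Finset (Finset γ₂), IsUpperSet (S : Set (Finset γ₂)) → 0 ≤ ∑ y ∈ Q, w₁ y * (ind S y - ind S yᶜ))
    (h₂ : ∀ S : Finset (Finset γ₂), IsUpperSet (S : Set (Finset γ₂)) → 0 ≤ ∑ y ∈ Q, w₂ y * (ind S y - ind S yᶜ))
    (S : Finset (Finset γ₂)) (hS : IsUpperSet (S : Set (Finset γ₂))) :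
    0 ≤ ∑ y ∈ Q, (w₁ y + w₂ y) * (ind S y - ind S yᶜ) := by
  have := h₁ S hS; have := h₂ S hS
  rw [sum_congr rfl fun y _ => by rw [add_mul], sum_add_distrib]
  linarith

/-- Admissible weights scale by non-negative factors. [this work] -/
theorem admissible_smul {Q : Finset (Finset γ₂)} {w : Finset γ₂ → ℤ} {c : ℤ} (hc : 0 ≤ c)
    (h : ∀ S : Finset (Finset γ₂), IsUpperSet (S : Set (Finset γ₂)) → 0 ≤ ∑ y ∈ Q, w y * (ind S y - ind S yᶜ))
    (S : Finset (Finset γ₂)) (hS : IsUpperSet (S : Set (Finset γ₂))) :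
    0 ≤ ∑ y ∈ Q, (c * w y) * (ind S y - ind S yᶜ) := by
  rw [sum_congr rfl fun y _ => by rw [mul_assoc], ← mul_sum]
  exact mul_nonneg hc (h S hS)

/-! ### The constant weight -/

/-- The constant weight `1` is admissible (it is `1_{univ}`). [this work] -/
theorem admissible_one {Q : Finset (Finset γ₂)} (hQ : IsUpperSet (Q : Set (Finset γ₂)))
    (S : Finset (Finset γ₂)) (hS : IsUpperSet (S : Set (Finset γ₂))) :
    0 ≤ ∑ y ∈ Q, ((fun _ => (1 : ℕ)) y : ℤ) * (ind S y - ind S yᶜ) := by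
  have h := admissible_ind_upset hQ (by rw [coe_univ]; exact isUpperSet_univ : IsUpperSet ((univ : Finset (Finset γ₂)) : Set (Finset γ₂))) S hS
  refine le_of_le_of_eq h (sum_congr rfl fun y _ => ?_)
  unfold ind; simp

end FiveUpSet

end Summit.CriticalPhenomena.PercolationContinuityZ3.Theorems
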